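import Summits.QuantumFields.BalabanUV.Beta.GAN24.DerivativeRateTransferRowDefect

/-!
# `BalabanUV.Beta.GAN24.DerivativeRateTransferRowDefectLattice` — binder row G-an2-4 ∕ (CONV-C), route R6 «VALUES, NOT DERIVATIVES», PART 31:
# THE FLAT TORUS ANCHOR OF (ROW) — PART 30's combinatorial hypotheses (weights summing to one, chain count, target count, the per-pair telescoping
# bound) DISCHARGED for the `U = 1` «prolongate multilinearly, then average» structure on the torus `(ℤ∕N)^d`:
# `(Mu)(z) = Σ_{k : Fin d → Bool} Π_ν (k_ν ? a : 1 − a) · u(z + Σ_{k_ν} e_ν)`, so that `|Q_c(Mu − u)|² ≤ (g_c·d∕w_f)·⟨u, H_f u⟩` for every transported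
# block averaging `Q_c` with column count `g_c` and every fine form above `w_f·Σ_e|D_e u|²` — hypothesis-free in `u` (unit b2b-balaban-gan24-p3, gen 38; v1)

NOT IN PRINT; OUR PROOF (for the ROUTE; [folklore] finite sums on `Fin d → ZMod N` + PART 30 BY NAME).  HONEST FRAMING (cell contract, verbatim): «discharging
`BetaPertH` makes Bałaban's UV stability UNCONDITIONAL — a real constructive-QFT result; it is NOT the continuum limit and NOT the Clay problem.»  HONEST DEPENDENCY
(verbatim): «continuum YM on T⁴ ⇐ BetaPertH ∧ nine spine estimates (0/9 proved); BetaPertH ⇐ (D1) ∧ (D4) ∧ CAP+tail; G-an2-4 gates asym, D1 and NE2/3/4.»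

THE STRUCTURE (no `def`; spelled out in the statements).  Sites `z : Fin d → ZMod N` (a level-`j` torus), colour space `o`, flags `k : Fin d → Bool`
(= the vertex set `T = {ν : k_ν}` of a cell), weights `c(k) = Π_ν (k_ν ? a : 1 − a)` (`0 ≤ a ≤ 1`; for the block mean of the multilinear interpolant
`a = (L−1)∕(2L)`), targets `τ(z,k) = z + Σ_ν [k_ν]·e_ν`, the MONOTONE STAIRCASE `xs(z,k,i) = z + Σ_{ν<i} [k_ν]·e_ν` (`i = 0 … d`; the step `i` moves by `e_i`
iff `k_i`, else stays), bonds `(x, ν)` from `x` to `x + e_ν`, the chain's `i`-th bond `(xs(z,k,i), i)` (charged whether or not the step moves — an upper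
bound costs nothing).  RESULTS: `Σ_k c(k) = 1` (§1); staircase bookkeeping (§2); the per-pair telescoping bound `|u(τ(z,k)) − u(z)|² ≤ d·Σ_{i<d}|D_{(xs_i, i)}u|²`
(§3); the chain count `≤ 1` and the target count `≤ 1` (§4: translation invariance of `Σ_z`); and (§5) PART 30's `sum_self_sub_le_core` + `dotProduct_self_avg_le`
assembled: **`rowDefect_flat_torus`** `|Q_c(Mu − u)|² ≤ (g_c·d∕w_f)·⟨u,H_fu⟩` — with `g_c = η^d` (unit blocks), `w_f = η^{d−2}` this is PART 29's (ROW) with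
`cϱ·(θ^j)² = d·η_j²·Λ`, `θ = L⁻¹`: FIRST ORDER, REGULARITY-FREE.

WHAT IT DOES NOT DO: identify `M` with `Qf_j·Pml` entrywise (the block mean of gan24-p2's `MultilinearProlongation.Pml` over `ℂ` on the `Tor` carriers — a
junction, ON REQUEST), (PROL), vector fields, backgrounds (PART 30's `rowDefect_holonomy` is the with-background letter).  SUPPLIER work on route R6 (rank 2,
REDUCTION, no seat); no consumer of record; NEVER «G-an2-4 closed»; NOT (CONV-C), NOT D1, NOT `BetaPertH`, NOT continuum, NOT Clay.
Records: `HOME/b2b-balaban-gan24-p3/WOODBURY-FIBRE.md` v13.8.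
-/

noncomputable section

open Matrix Finset

namespace Summit.QuantumFields.BalabanUV.Beta.GAN24.DerivativeRateTransferRowDefectLattice

open Summit.QuantumFields.BalabanUV.Beta.GAN24.DerivativeRateTransferJensenChain (dotProduct_self_sum_le_card_mul dotProduct_self_nonneg')
open Summit.QuantumFields.BalabanUV.Beta.GAN24.DerivativeRateTransferRowDefect (sum_self_sub_le_core dotProduct_self_avg_le)

variable {d N : ℕ}

/-! ## §1 The cell weights sum to one -/

section Weights

/-- **`Σ_k Π_ν (k_ν ? a : 1 − a) = 1`** (the product of `a + (1 − a)` over the directions). [folklore] -/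
theorem sum_flagWeight (a : ℝ) : ∑ k : Fin d → Bool, ∏ ν, (if k ν = true then a else 1 - a) = 1 := by
  have h := Finset.prod_univ_sum (fun _ : Fin d => (Finset.univ : Finset Bool)) (fun _ b => if b = true then a else 1 - a)
  rw [Fintype.piFinset_univ] at h
  rw [← h]
  simp

/-- the cell weights are nonnegative for `0 ≤ a ≤ 1`. [folklore] -/
theorem flagWeight_nonneg {a : ℝ} (ha0 : 0 ≤ a) (ha1 : a ≤ 1) (k : Fin d → Bool) :
    0 ≤ ∏ ν, (if k ν = true then a else 1 - a) :=
  Finset.prod_nonneg fun ν _ => by split_ifs <;> linarith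

end Weights

/-! ## §2 The monotone staircase `xs(z,k,i) = z + Σ_{ν<i} [k_ν]·e_ν` -/

section Staircase

/-- no step below `0`. [folklore] -/
theorem stepSum_zero (k : Fin d → Bool) :
    (∑ ν : Fin d, if (ν : ℕ) < 0 ∧ k ν = true then (Pi.single ν (1 : ZMod N) : Fin d → ZMod N) else 0) = 0 := by
  simp

/-- **THE STAIRCASE STEP**: `xs(i+1) = xs(i) + [k_i]·e_i` for `i < d`. [folklore] -/
theorem stepSum_succ (k : Fin d → Bool) {i : ℕ} (hi : i < d) :
    (∑ ν : Fin d, if (ν : ℕ) < i + 1 ∧ k ν = true then (Pi.single ν (1 : ZMod N) : Fin d → ZMod N) else 0) =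
      (∑ ν : Fin d, if (ν : ℕ) < i ∧ k ν = true then (Pi.single ν (1 : ZMod N) : Fin d → ZMod N) else 0) +
        (if k ⟨i, hi⟩ = true then (Pi.single (⟨i, hi⟩ : Fin d) (1 : ZMod N) : Fin d → ZMod N) else 0) := by
  have hlast : (if k ⟨i, hi⟩ = true then (Pi.single (⟨i, hi⟩ : Fin d) (1 : ZMod N) : Fin d → ZMod N) else 0) =
      ∑ ν : Fin d, if ν = ⟨i, hi⟩ then (if k ν = true then (Pi.single ν (1 : ZMod N) : Fin d → ZMod N) else 0) else 0 := by
    rw [Finset.sum_ite_eq' Finset.univ (⟨i, hi⟩ : Fin d)]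
    simp
  rw [hlast, ← Finset.sum_add_distrib]
  refine Finset.sum_congr rfl fun ν _ => ?_
  by_cases h1 : (ν : ℕ) < i
  · have h2 : (ν : ℕ) < i + 1 := Nat.lt_succ_of_lt h1
    have h3 : ν ≠ ⟨i, hi⟩ := fun h => by rw [h] at h1; exact lt_irrefl _ h1
    rw [if_neg h3, add_zero]
    by_cases hk : k ν = true
    · rw [if_pos ⟨h2, hk⟩, if_pos ⟨h1, hk⟩]
    · rw [if_neg (fun h => hk h.2), if_neg (fun h => hk h.2)]
  · by_cases h4 : (ν : ℕ) = i
    · have h5 : ν = ⟨i, hi⟩ := Fin.ext h4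
      have h2 : (ν : ℕ) < i + 1 := by omega
      rw [if_pos h5]
      by_cases hk : k ν = true
      · rw [if_pos ⟨h2, hk⟩, if_neg (show ¬((ν : ℕ) < i ∧ k ν = true) from fun h => h1 h.1), if_pos hk, zero_add]
      · rw [if_neg (show ¬((ν : ℕ) < i + 1 ∧ k ν = true) from fun h => hk h.2),
          if_neg (show ¬((ν : ℕ) < i ∧ k ν = true) from fun h => hk h.2), if_neg hk, zero_add]
    · have h2 : ¬ (ν : ℕ) < i + 1 := by omega
      have h3 : ν ≠ ⟨i, hi⟩ := fun h => h4 (by rw [h])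
      rw [if_neg h3, add_zero, if_neg (fun h => h2 h.1), if_neg (fun h => h1 h.1)]

/-- past the last direction the staircase is the full vertex vector: `xs(i) = Σ_ν [k_ν]·e_ν` for `d ≤ i`. [folklore] -/
theorem stepSum_of_le (k : Fin d → Bool) {i : ℕ} (hi : d ≤ i) :
    (∑ ν : Fin d, if (ν : ℕ) < i ∧ k ν = true then (Pi.single ν (1 : ZMod N) : Fin d → ZMod N) else 0) =
      ∑ ν : Fin d, if k ν = true then (Pi.single ν (1 : ZMod N) : Fin d → ZMod N) else 0 := by
  refine Finset.sum_congr rfl fun ν _ => ?_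
  have : (ν : ℕ) < i := lt_of_lt_of_le ν.is_lt hi
  simp only [this, true_and]

end Staircase

/-! ## §3 The per-pair telescoping bound along the staircase -/

section Pair

variable {o : Type*} [Fintype o] [DecidableEq o]

/-- **`pair_flat_torus` — THE PER-PAIR BOUND** [our proof]: `|u(z + Σ_ν[k_ν]e_ν) − u(z)|² ≤ 1·(d·Σ_{i<d} |u(xs_i + e_i) − u(xs_i)|²) + 0·|u(τ)|²` — the
staircase telescopes, `|Σ_{i<d} v_i|² ≤ d·Σ|v_i|²`, and the step `i` is the bond difference when `k_i` and `0` otherwise (PART 30's `hpair` shape with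
`O = 1`, `R = 1`, `ℓ = d`, the `i`-th bond `(xs_i, i)`). -/
theorem pair_flat_torus [NeZero d] (k : Fin d → Bool) (u : (Fin d → ZMod N) × o → ℝ) (z : Fin d → ZMod N) :
    (((1 : Matrix o o ℝ) *ᵥ fun b => u (z + ∑ ν : Fin d, (if k ν = true then (Pi.single ν (1 : ZMod N) : Fin d → ZMod N) else 0), b)) -
        fun b => u (z, b)) ⬝ᵥ
      (((1 : Matrix o o ℝ) *ᵥ fun b => u (z + ∑ ν : Fin d, (if k ν = true then (Pi.single ν (1 : ZMod N) : Fin d → ZMod N) else 0), b)) -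
        fun b => u (z, b)) ≤
      1 * ((d : ℝ) * ∑ i ∈ range d,
        (((1 : Matrix o o ℝ) *ᵥ fun b => u ((z + ∑ ν : Fin d, (if (ν : ℕ) < i ∧ k ν = true then (Pi.single ν (1 : ZMod N) : Fin d → ZMod N) else 0))
              + Pi.single (Fin.ofNat d i) (1 : ZMod N), b)) -
            fun b => u (z + ∑ ν : Fin d, (if (ν : ℕ) < i ∧ k ν = true then (Pi.single ν (1 : ZMod N) : Fin d → ZMod N) else 0), b)) ⬝ᵥ
          (((1 : Matrix o o ℝ) *ᵥ fun b => u ((z + ∑ ν : Fin d, (if (ν : ℕ) < i ∧ k ν = true then (Pi.single ν (1 : ZMod N) : Fin d → ZMod N) else 0))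
              + Pi.single (Fin.ofNat d i) (1 : ZMod N), b)) -
            fun b => u (z + ∑ ν : Fin d, (if (ν : ℕ) < i ∧ k ν = true then (Pi.single ν (1 : ZMod N) : Fin d → ZMod N) else 0), b))) +
        0 * ((fun b => u (z + ∑ ν : Fin d, (if k ν = true then (Pi.single ν (1 : ZMod N) : Fin d → ZMod N) else 0), b)) ⬝ᵥ
          fun b => u (z + ∑ ν : Fin d, (if k ν = true then (Pi.single ν (1 : ZMod N) : Fin d → ZMod N) else 0), b)) := by
  simp only [one_mulVec, one_mul, zero_mul, add_zero]
  set w : ℕ → o → ℝ := fun i => fun b =>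
    u (z + ∑ ν : Fin d, (if (ν : ℕ) < i ∧ k ν = true then (Pi.single ν (1 : ZMod N) : Fin d → ZMod N) else 0), b) with hw
  have htel : ((fun b => u (z + ∑ ν : Fin d, (if k ν = true then (Pi.single ν (1 : ZMod N) : Fin d → ZMod N) else 0), b)) - fun b => u (z, b)) =
      ∑ i ∈ range d, (w (i + 1) - w i) := by
    rw [Finset.sum_range_sub, hw]
    simp only [stepSum_of_le k le_rfl, stepSum_zero, add_zero]
  rw [htel]
  refine (dotProduct_self_sum_le_card_mul _ _).trans ?_
  rw [card_range]
  refine mul_le_mul_of_nonneg_left (Finset.sum_le_sum fun i hi => ?_) (Nat.cast_nonneg _)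
  have hid : i < d := mem_range.mp hi
  have hofNat : (Fin.ofNat d i : Fin d) = ⟨i, hid⟩ := Fin.ext (by rw [Fin.val_ofNat, Nat.mod_eq_of_lt hid])
  rw [hw]
  simp only [stepSum_succ k hid, hofNat]
  by_cases hk : k ⟨i, hid⟩ = true
  · rw [if_pos hk, add_assoc]
  · rw [if_neg hk, add_zero, sub_self, zero_dotProduct]
    exact dotProduct_self_nonneg' _

end Pair

/-! ## §4 The two counts: translation invariance of `Σ_z` -/

section Counts

variable [NeZero N]

/-- `Σ_z [z + s = x]·c = c` on the torus. [folklore] -/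
theorem sum_ite_add_eq (s x : Fin d → ZMod N) (cst : ℝ) : ∑ z : Fin d → ZMod N, (if z + s = x then cst else 0) = cst := by
  have h : ∀ z : Fin d → ZMod N, (z + s = x) ↔ (z = x - s) := fun z => by rw [eq_sub_iff_add_eq]
  simp_rw [h]
  rw [Finset.sum_ite_eq' Finset.univ (x - s) (fun _ => cst)]
  simp

/-- **THE TARGET COUNT `≤ 1`**: every site is the target `τ(z,k) = z + Σ_ν[k_ν]e_ν` with total weight `Σ_k c(k) = 1`. [our proof] -/
theorem targetCount_le (a : ℝ) (x : Fin d → ZMod N) :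
    ∑ z : Fin d → ZMod N, ∑ k : Fin d → Bool,
        (if z + ∑ ν : Fin d, (if k ν = true then (Pi.single ν (1 : ZMod N) : Fin d → ZMod N) else 0) = x
          then ∏ ν, (if k ν = true then a else 1 - a) else 0) ≤ 1 := by
  rw [Finset.sum_comm]
  simp_rw [sum_ite_add_eq]
  rw [sum_flagWeight]

/-- **THE CHAIN COUNT `≤ 1`**: the bond `(x, ν)` is the `i`-th bond of the staircase of `(z,k)` only for `i = ν` and then for exactly one `z` per `k`. [our proof] -/
theorem chainCount_le [NeZero d] (a : ℝ) (e : (Fin d → ZMod N) × Fin d) :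
    ∑ z : Fin d → ZMod N, ∑ k : Fin d → Bool, ∑ i ∈ range d,
        (if ((z + ∑ ν : Fin d, (if (ν : ℕ) < i ∧ k ν = true then (Pi.single ν (1 : ZMod N) : Fin d → ZMod N) else 0), Fin.ofNat d i) = e)
          then ∏ ν, (if k ν = true then a else 1 - a) else 0) ≤ 1 := by
  obtain ⟨x, μ⟩ := e
  have hinner : ∀ (z : Fin d → ZMod N) (k : Fin d → Bool),
      (∑ i ∈ range d,
        (if ((z + ∑ ν : Fin d, (if (ν : ℕ) < i ∧ k ν = true then (Pi.single ν (1 : ZMod N) : Fin d → ZMod N) else 0), Fin.ofNat d i) = (x, μ))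
          then ∏ ν, (if k ν = true then a else 1 - a) else 0)) =
        if z + ∑ ν : Fin d, (if (ν : ℕ) < (μ : ℕ) ∧ k ν = true then (Pi.single ν (1 : ZMod N) : Fin d → ZMod N) else 0) = x
          then ∏ ν, (if k ν = true then a else 1 - a) else 0 := by
    intro z k
    rw [Finset.sum_eq_single_of_mem (μ : ℕ) (mem_range.mpr μ.is_lt)]
    · have hμ : (Fin.ofNat d (μ : ℕ) : Fin d) = μ := Fin.ext (by rw [Fin.val_ofNat, Nat.mod_eq_of_lt μ.is_lt])
      simp only [hμ, Prod.mk.injEq, and_true]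
    · intro i hi hne
      have hid : i < d := mem_range.mp hi
      have hμ : (Fin.ofNat d i : Fin d) ≠ μ := fun h => hne (by rw [← h, Fin.val_ofNat, Nat.mod_eq_of_lt hid])
      rw [if_neg]
      exact fun h => hμ (Prod.mk.inj h).2
  simp_rw [hinner]
  rw [Finset.sum_comm]
  simp_rw [sum_ite_add_eq]
  rw [sum_flagWeight]

end Counts

/-! ## §5 THE END: (ROW) on the flat torus, hypothesis-free in `u` -/

section End

variable [NeZero d] [NeZero N] {o c : Type*} [Fintype o] [DecidableEq o] [Fintype c]

/-- **`rowDefect_flat_torus` — (ROW) FOR «PROLONGATE MULTILINEARLY, THEN AVERAGE» ON THE FLAT TORUS** [our proof]: `0 ≤ a ≤ 1`; a map `M` with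
`(Mu)(z) = Σ_k Π_ν(k_ν ? a : 1−a)·u(z + Σ_ν[k_ν]e_ν)`; ANY transported block averaging `Q_c` to the unit level (weights `q_c ≥ 0`, `Σ_z q_c(y,z) ≤ 1`, orthogonal
`W_c`, column count `Σ_y q_c(y,z) ≤ g_c`, `0 ≤ g_c`); ANY fine form with `w_f·Σ_{(x,ν)}|u(x + e_ν) − u(x)|² ≤ ⟨u, H_f u⟩` (`0 < w_f`) ⟹ for EVERY `u`:
`|Q_c(Mu − u)|² ≤ (g_c·d∕w_f)·⟨u, H_f u⟩`.  (PART 30 with `m = g = 1`, `ℓ = d`, `O = R = 1`.) -/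
theorem rowDefect_flat_torus {a : ℝ} (ha0 : 0 ≤ a) (ha1 : a ≤ 1)
    {M : Matrix ((Fin d → ZMod N) × o) ((Fin d → ZMod N) × o) ℝ}
    (hM : ∀ (u : (Fin d → ZMod N) × o → ℝ) (z : Fin d → ZMod N), (fun b => (M *ᵥ u) (z, b)) =
      ∑ k : Fin d → Bool, (∏ ν, (if k ν = true then a else 1 - a)) •
        ((1 : Matrix o o ℝ) *ᵥ fun b => u (z + ∑ ν : Fin d, (if k ν = true then (Pi.single ν (1 : ZMod N) : Fin d → ZMod N) else 0), b)))
    {qc : c → (Fin d → ZMod N) → ℝ} {Wc : c → (Fin d → ZMod N) → Matrix o o ℝ} {Qc : Matrix (c × o) ((Fin d → ZMod N) × o) ℝ}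
    (hq0 : ∀ y z, 0 ≤ qc y z) (hq1 : ∀ y, ∑ z, qc y z ≤ 1) (hW : ∀ y z, (Wc y z)ᵀ * Wc y z = 1)
    (hQc : ∀ (w : (Fin d → ZMod N) × o → ℝ) (y : c), (fun b => (Qc *ᵥ w) (y, b)) = ∑ z, qc y z • (Wc y z *ᵥ fun b => w (z, b)))
    {gc : ℝ} (hcol : ∀ z, ∑ y, qc y z ≤ gc) (hgc : 0 ≤ gc)
    {Hf : Matrix ((Fin d → ZMod N) × o) ((Fin d → ZMod N) × o) ℝ} {wf : ℝ} (hwf : 0 < wf)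
    (hHf : ∀ u : (Fin d → ZMod N) × o → ℝ,
      wf * ∑ e : (Fin d → ZMod N) × Fin d, ((fun b => u (e.1 + Pi.single e.2 (1 : ZMod N), b)) - fun b => u (e.1, b)) ⬝ᵥ
        ((fun b => u (e.1 + Pi.single e.2 (1 : ZMod N), b)) - fun b => u (e.1, b)) ≤ u ⬝ᵥ (Hf *ᵥ u))
    (u : (Fin d → ZMod N) × o → ℝ) :
    (Qc *ᵥ (M *ᵥ u - u)) ⬝ᵥ (Qc *ᵥ (M *ᵥ u - u)) ≤ gc * d / wf * (u ⬝ᵥ (Hf *ᵥ u)) := by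
  have hcore := fun hp => sum_self_sub_le_core (o := o) (μ := Fin d → ZMod N) (K := Fin d → Bool) (β := (Fin d → ZMod N) × Fin d)
      (cw := fun _ k => ∏ ν, (if k ν = true then a else 1 - a)) (O := fun _ _ => (1 : Matrix o o ℝ))
      (τ := fun z k => z + ∑ ν : Fin d, (if k ν = true then (Pi.single ν (1 : ZMod N) : Fin d → ZMod N) else 0)) (M := M)
      (src := fun e => e.1) (tgt := fun e => e.1 + Pi.single e.2 (1 : ZMod N)) (R := fun _ => (1 : Matrix o o ℝ)) (ℓmax := d)
      (ℓ := fun _ _ => d)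
      (γ := fun z k i =>
        (z + ∑ ν : Fin d, (if (ν : ℕ) < i ∧ k ν = true then (Pi.single ν (1 : ZMod N) : Fin d → ZMod N) else 0), Fin.ofNat d i))
      (m := 1) (g := 1) (A := 1) (Bk := 0) (fun _ k => flagWeight_nonneg ha0 ha1 k) (fun _ => sum_flagWeight a) hM
      (chainCount_le a) (targetCount_le a) zero_le_one le_rfl u hp
  -- the per-pair goal carries the projections `(x, ν).1 ∕ (x, ν).2` of the chain's bond letters: reduce them, then PART 31 §3 applies verbatim
  have key : (M *ᵥ u - u) ⬝ᵥ (M *ᵥ u - u) ≤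
      (d : ℝ) * ∑ e : (Fin d → ZMod N) × Fin d, ((fun b => u (e.1 + Pi.single e.2 (1 : ZMod N), b)) - fun b => u (e.1, b)) ⬝ᵥ
        ((fun b => u (e.1 + Pi.single e.2 (1 : ZMod N), b)) - fun b => u (e.1, b)) := by
    refine (hcore ?_).trans (le_of_eq ?_)
    · intro z k
      dsimp only
      exact pair_flat_torus k u z
    · simp only [one_mulVec, one_mul, zero_mul, add_zero]
  have havg := dotProduct_self_avg_le hq0 hq1 hW hQc hcol (M *ᵥ u - u)
  refine havg.trans ?_
  have h2 : ∑ e : (Fin d → ZMod N) × Fin d, ((fun b => u (e.1 + Pi.single e.2 (1 : ZMod N), b)) - fun b => u (e.1, b)) ⬝ᵥ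
      ((fun b => u (e.1 + Pi.single e.2 (1 : ZMod N), b)) - fun b => u (e.1, b)) ≤ (u ⬝ᵥ (Hf *ᵥ u)) / wf := by
    rw [le_div_iff₀ hwf, mul_comm]; exact hHf u
  have h3 : (d : ℝ) * ∑ e : (Fin d → ZMod N) × Fin d, ((fun b => u (e.1 + Pi.single e.2 (1 : ZMod N), b)) - fun b => u (e.1, b)) ⬝ᵥ
      ((fun b => u (e.1 + Pi.single e.2 (1 : ZMod N), b)) - fun b => u (e.1, b)) ≤ d * ((u ⬝ᵥ (Hf *ᵥ u)) / wf) :=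
    mul_le_mul_of_nonneg_left h2 (Nat.cast_nonneg _)
  calc gc * ((M *ᵥ u - u) ⬝ᵥ (M *ᵥ u - u)) ≤ gc * (d * ((u ⬝ᵥ (Hf *ᵥ u)) / wf)) :=
        mul_le_mul_of_nonneg_left (key.trans h3) hgc
    _ = gc * d / wf * (u ⬝ᵥ (Hf *ᵥ u)) := by
        field_simp

end End

end Summit.QuantumFields.BalabanUV.Beta.GAN24.DerivativeRateTransferRowDefectLattice

end
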